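import Mathlib
import Summits.ValiantsHypothesis.ValiantsHypothesis.Theorems.BarrierLeverPartitionMinorsHitByVPHiddenStatesCoStarSatFour

/-!
# Route BarrierLever — item `PartitionMinorsHitByVP` (stmt-ValiantsHypothesis-19717), line `hidden-states`:
# THE CO-STAR RECURSION, part 4 — THE STUCK REDUCTION: lower co-stars at co-size `c + 1`, for EVERY `h`, from the finitely many STUCK
# saturated shapes of dimension `c`

Helper file (`--supports stmt-ValiantsHypothesis-19717`; cell valiant-natproofs, rung V4, 𝒟-side door (c), registered line
`Cruxes/PartitionMinorsHitByVP/Lines/hidden_states.lean` v7; prover seat val-np-p6 gen 11). Definition-free; closes NO item.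

THE POINT. The BLOCK REDUCTION of memo val-np-p6 g10 §10 says (on paper, by a Kronecker/Jacobi argument): «the co-star `T_{h,c}` serves every
down-set of co-size `c+1` for ALL `h` iff the saturated ball `B_{c−2}([c])` serves the complement of every up-set of size `c+1` in `2^{[c]}`» — one
finite check per `c`. The recursion of parts 1–3b gives a SHARPER kernel statement with no linear algebra: the facet stacks (R1)/(R2′) run in every
dimension until they reach a saturated node (`d = c`, all states special) at which NO coordinate is avoided by exactly one missing row — a STUCK
shape. Hence:

* `coStar_subcube_symGood_of_stuck` — for any `cmax`: if every STUCK saturated sub-cube instance of dimension `5 ≤ c ≤ cmax` is generically good,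
  then every sub-cube co-star instance with `≤ cmax` special states is generically good in every dimension (dimension 4 is never stuck by
  `CoStar.satFour`, dimensions `≤ 3` are free leaves).
* `coStarLower_exists_table_of_stuck` — consequently the LOWER CO-STAR THEOREM at co-size `c+1` for EVERY `h` (verbatim the lower form of the
  hypothesis `hC` of `CoStar.universalJoinWide_of_coStarAll`), and
* `universalJoinWideLower_of_stuck` — the body of `LowerNode.Stmt.universalJoinWideLower` at `(h, 2^h − (c+1))`, `c ≤ h`, `1 ≤ h`,
  both conditional on the stuck shapes of dimensions `5..c` only.

THE FINITE RESIDUE (census, this seat; kit/satcert.py, --workitem 19717): up to `S_c`-symmetry the stuck saturated shapes are — dimension 5: ONE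
(`𝒜 = {Y, Y∖a, Y∖b, Y∖c, Y∖ab, Y∖ac}`; complement down-set `{∅,a,b,c,ab,ac}`), and it IS certifiable by general affine cuts (AF⁺, `ctlib.Solver`:
a 25-node cut tree, root cut «exactly one of two special states», children 14/12) though not by facet stacks; dimensions 6, 7: kit j304901.
So co-size 6 for all `h` is ONE generated certificate file away (pipeline `SymbJoin.symGood_of_split_enum` / val-np-p3 g10 `lab/cert2lean.py` +
a transport lemma for relabelled blocks). WHAT THIS IS NOT: the stuck shapes are NOT proved here; no stub of the line is closed; nothing on crux
14610 or VP ≠ VNP.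
-/

set_option linter.dupNamespace false

namespace Summit.ValiantsHypothesis.ValiantsHypothesis.Theorems.BarrierLever.HiddenStates

open Finset Matrix MvPolynomial

noncomputable section

namespace SymbJoin

variable {n m K r : ℕ}

/-! ## 1. The stuck reduction (sub-cube form) -/

/-- **THE CO-STAR RECURSION THEOREM, STUCK FORM (every `c`).** If every STUCK saturated sub-cube co-star instance of dimension
`5 ≤ d = c ≤ cmax` (all states special, no coordinate avoided by exactly one missing row) is generically good, then EVERY sub-cube co-star
instance with `c ≤ cmax` special states is generically good, in every dimension. (Dimensions `c ≤ 3` saturate into free leaves and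
dimension `4` is never stuck, `CoStar.satFour`; so for `cmax ≤ 4` the hypothesis is vacuous and this is `coStar_subcube_symGood`.) -/
theorem coStar_subcube_symGood_of_stuck (p₀ : Fin m) (cmax : ℕ)
    (hstuck : ∀ (Y : Finset (Fin n)) (Q : Finset (Fin K)) (𝒜 : Finset (Finset (Fin n))) (r : ℕ)
      (u : Fin r → Finset (Fin n)) (cols : Fin r → Finset (Fin K)),
      Y.card = Q.card → 5 ≤ Q.card → Q.card ≤ cmax →
      (∀ A ∈ 𝒜, A ⊆ Y) → (∀ A ∈ 𝒜, ∀ A', A ⊆ A' → A' ⊆ Y → A' ∈ 𝒜) → 𝒜.card = Q.card + 1 →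
      (∀ x ∈ Y, (𝒜.filter fun A => x ∉ A).card ≠ 1) →
      Function.Injective u → (∀ S, (∃ i, u i = S) ↔ S ⊆ Y ∧ S ∉ 𝒜) →
      Function.Injective cols → (∀ J, (∃ k, cols k = J) ↔ J ⊆ Q ∧ J ≠ Q ∧ ∀ q ∈ Q, J ≠ Q.erase q) →
      symDet u (fun k => (p₀, cols k)) ≠ 0) :
    ∀ (d : ℕ) (Y : Finset (Fin n)) (Q Qs : Finset (Fin K)) (𝒜 : Finset (Finset (Fin n))) (r : ℕ)
      (u : Fin r → Finset (Fin n)) (cols : Fin r → Finset (Fin K)),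
      Y.card = d → Q.card = d → Qs ⊆ Q → Qs.card ≤ cmax →
      (∀ A ∈ 𝒜, A ⊆ Y) → (∀ A ∈ 𝒜, ∀ A', A ⊆ A' → A' ⊆ Y → A' ∈ 𝒜) → 𝒜.card = Qs.card + 1 →
      Function.Injective u → (∀ S, (∃ i, u i = S) ↔ S ⊆ Y ∧ S ∉ 𝒜) →
      Function.Injective cols → (∀ J, (∃ k, cols k = J) ↔ J ⊆ Q ∧ J ≠ Q ∧ ∀ q ∈ Qs, J ≠ Q.erase q) →
      symDet u (fun k => (p₀, cols k)) ≠ 0 := by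
  classical
  intro d
  induction d with
  | zero =>
    intro Y Q Qs 𝒜 r u cols hY hQ hQs _ h𝒜Y hup h𝒜c hu hrows hcols hcolr
    have hQe : Q = ∅ := Finset.card_eq_zero.mp hQ
    have hQse : Qs = ∅ := Finset.subset_empty.mp (hQe ▸ hQs)
    rw [hQse, Finset.card_empty, zero_add] at h𝒜c
    exact coStar_subcube_zero p₀ Y Q 𝒜 u cols (hY.trans hQ.symm) h𝒜Y hup h𝒜c hu hrows hcols
      fun k => let h := (hcolr _).mp ⟨k, rfl⟩; ⟨h.1, h.2.1⟩
  | succ d ih =>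
    intro Y Q Qs 𝒜 r u cols hY hQ hQs hcle h𝒜Y hup h𝒜c hu hrows hcols hcolr
    have hYQ : Y.card = Q.card := hY.trans hQ.symm
    have hYne : Y.Nonempty := Finset.card_pos.mp (by omega)
    -- c = 0
    by_cases hc0 : Qs = ∅
    · subst hc0
      rw [Finset.card_empty, zero_add] at h𝒜c
      exact coStar_subcube_zero p₀ Y Q 𝒜 u cols hYQ h𝒜Y hup h𝒜c hu hrows hcols
        fun k => let h := (hcolr _).mp ⟨k, rfl⟩; ⟨h.1, h.2.1⟩
    have hQsne : Qs.Nonempty := Finset.nonempty_iff_ne_empty.mpr hc0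
    by_cases hx1 : ∃ x ∈ Y, (𝒜.filter fun A => x ∉ A).card = 1
    · obtain ⟨x, hxY, hax⟩ := hx1 -- (R2′): stack on `x` with a special marker `q`
      obtain ⟨q, hqs⟩ := hQsne
      have hqQ : q ∈ Q := hQs hqs
      obtain ⟨A₁, hA₁⟩ := Finset.card_eq_one.mp hax
      have hA₁mem : A₁ ∈ 𝒜 ∧ x ∉ A₁ := by
        have : A₁ ∈ 𝒜.filter fun A => x ∉ A := by rw [hA₁]; exact Finset.mem_singleton_self _
        exact Finset.mem_filter.mp this
      have hYx : Y.erase x ∈ 𝒜 := hup A₁ hA₁mem.1 _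
        (fun y hy => Finset.mem_erase.mpr ⟨fun h => hA₁mem.2 (h ▸ hy), h𝒜Y A₁ hA₁mem.1 hy⟩) (Finset.erase_subset x Y)
      have huniq : ∀ A ∈ 𝒜, x ∉ A → A = Y.erase x := by
        intro A hA hxA
        have h1 : A ∈ 𝒜.filter fun A => x ∉ A := Finset.mem_filter.mpr ⟨hA, hxA⟩
        have h2 : Y.erase x ∈ 𝒜.filter fun A => x ∉ A := Finset.mem_filter.mpr ⟨hYx, Finset.notMem_erase x Y⟩
        rw [hA₁, Finset.mem_singleton] at h1 h2
        rw [h1, h2]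
      refine symGood_of_stack_pred p₀ u cols x q ?_ ?_ ?_
      · have h1 := card_rows_avoid Y 𝒜 x hxY h𝒜Y u hu hrows
        have h2 := card_cols_avoid Q Qs q hqQ cols hcols hcolr
        rw [hax, hY] at h1
        rw [if_pos hqs, hQ] at h2
        omega
      · intro r₀ f g hf hg hfx hfs hgq _
        refine symGood_subcube_top p₀ _ (hu.comp hf) _ (hcols.comp hg) (Y.erase x) (Q.erase q) ?_ ?_ ?_
        · rw [Finset.card_erase_of_mem hxY, Finset.card_erase_of_mem hqQ, hYQ]
        · intro j
          obtain ⟨hCQ, -, hCs⟩ := (hcolr _).mp ⟨g j, rfl⟩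
          exact ⟨fun y hy => Finset.mem_erase.mpr ⟨fun h => hgq j (h ▸ hy), hCQ hy⟩, hCs q hqs⟩
        · intro S hSY hSne
          have hxS : x ∉ S := fun h => Finset.notMem_erase x Y (hSY h)
          obtain ⟨i, hi⟩ := (hrows S).mpr ⟨hSY.trans (Finset.erase_subset x Y), fun hS => hSne (huniq S hS hxS)⟩
          obtain ⟨j, rfl⟩ := hfs i (hi ▸ hxS)
          exact ⟨j, hi⟩
      · intro r₁ f g hf hg hfx hfs hgq hgs
        obtain ⟨hinj, hran⟩ := linkRows_range Y 𝒜 x hxY u hu hrows f hf hfx hfs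
        obtain ⟨hcinj, hcran⟩ := linkCols_range Q Qs q hqQ cols hcols hcolr g hg hgq hgs
        have hfilt : (𝒜.filter fun A => x ∈ A).card = Qs.card := by
          have := Finset.card_filter_add_card_filter_not (s := 𝒜) (fun A => x ∈ A); rw [hax, h𝒜c] at this; omega
        refine ih (Y.erase x) (Q.erase q) (Qs.erase q) ((𝒜.filter fun A => x ∈ A).image fun A => A.erase x) r₁
          (fun j => (u (f j)).erase x) (fun j => (cols (g j)).erase q) ?_ ?_ ?_ ?_
          (linkFamily_subset Y 𝒜 x h𝒜Y) (linkFamily_up Y 𝒜 x hxY hup) ?_ hinj hran hcinj hcran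
        · rw [Finset.card_erase_of_mem hxY, hY]; rfl
        · rw [Finset.card_erase_of_mem hqQ, hQ]; rfl
        · exact Finset.erase_subset_erase q hQs
        · rw [Finset.card_erase_of_mem hqs]; omega
        · rw [linkFamily_card, hfilt, Finset.card_erase_of_mem hqs]
          have := Finset.card_pos.mpr ⟨q, hqs⟩
          omega
    · push Not at hx1
      by_cases hsat : Qs = Q
      · by_cases hd3 : d + 1 ≤ 3 -- saturated: `c = d`
        · -- free leaf: every column has at most one state
          refine symGood_of_cols_card_le_one p₀ u hu cols hcols fun k => ?_ -- free leaf: |column| ≤ 1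
          obtain ⟨hCQ, hCne, hCs⟩ := (hcolr _).mp ⟨k, rfl⟩
          rw [hsat] at hCs
          have h2 : 2 ≤ (Q \ cols k).card := by
            by_contra hlt
            push Not at hlt
            interval_cases hsd : (Q \ cols k).card
            · apply hCne
              exact (Finset.eq_of_subset_of_card_le hCQ (by
                have := Finset.card_sdiff_add_card_eq_card hCQ; omega)).symm ▸ rfl
            · obtain ⟨q, hq⟩ := Finset.card_eq_one.mp hsd
              have hqm : q ∈ Q \ cols k := by rw [hq]; exact Finset.mem_singleton_self _
              apply hCs q (Finset.mem_sdiff.mp hqm).1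
              ext y
              simp only [Finset.mem_erase]
              constructor
              · exact fun hy => ⟨fun h => (Finset.mem_sdiff.mp hqm).2 (h ▸ hy), hCQ hy⟩
              · rintro ⟨hyq, hyQ⟩
                by_contra hyC
                have : y ∈ Q \ cols k := Finset.mem_sdiff.mpr ⟨hyQ, hyC⟩
                rw [hq, Finset.mem_singleton] at this
                exact hyq this
          have := Finset.card_sdiff_add_card_eq_card hCQ
          omega
        · subst hsat
          by_cases hd4 : d + 1 = 4
          · exfalso
            obtain ⟨x, hxY, hx⟩ := CoStar.satFour Y 𝒜 (hY.trans hd4) h𝒜Y hup (by rw [h𝒜c, hQ, hd4])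
            exact hx1 x hxY hx
          · exact hstuck Y Qs 𝒜 r u cols hYQ (by omega) hcle h𝒜Y hup h𝒜c hx1 hu hrows hcols hcolr
      · -- (R1): a coordinate in every missing row, a non-special marker
        obtain ⟨q₀, hq₀Q, hq₀s⟩ := Finset.exists_of_ssubset (Finset.ssubset_iff_subset_ne.mpr ⟨hQs, hsat⟩)
        obtain ⟨x, hxY, hax⟩ := exists_coord_avoid_le_one Y 𝒜 h𝒜Y hup (Finset.card_pos.mp (by omega))
          (by rw [h𝒜c, hYQ]; have := Finset.card_le_card hQs; omega) hYne
        have hax0 : (𝒜.filter fun A => x ∉ A).card = 0 := by have := hx1 x hxY; omega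
        have hall : ∀ A ∈ 𝒜, x ∈ A := fun A hA => by
          by_contra hxA
          have : A ∈ 𝒜.filter fun A => x ∉ A := Finset.mem_filter.mpr ⟨hA, hxA⟩
          rw [Finset.card_eq_zero.mp hax0] at this; exact Finset.notMem_empty A this
        refine symGood_of_stack_pred p₀ u cols x q₀ ?_ ?_ ?_
        · have h1 := card_rows_avoid Y 𝒜 x hxY h𝒜Y u hu hrows
          have h2 := card_cols_avoid Q Qs q₀ hq₀Q cols hcols hcolr
          rw [hax0, hY] at h1
          rw [if_neg hq₀s, hQ] at h2
          omega
        · intro r₀ f g hf hg hfx hfs hgq _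
          refine symGood_subcube_full p₀ _ (hu.comp hf) _ (hcols.comp hg) (Y.erase x) (Q.erase q₀) ?_ ?_ ?_
          · rw [Finset.card_erase_of_mem hxY, Finset.card_erase_of_mem hq₀Q, hYQ]
          · intro j
            obtain ⟨hCQ, -, -⟩ := (hcolr _).mp ⟨g j, rfl⟩
            exact fun y hy => Finset.mem_erase.mpr ⟨fun h => hgq j (h ▸ hy), hCQ hy⟩
          · intro S hSY
            have hxS : x ∉ S := fun h => Finset.notMem_erase x Y (hSY h)
            obtain ⟨i, hi⟩ := (hrows S).mpr ⟨hSY.trans (Finset.erase_subset x Y), fun hS => hxS (hall S hS)⟩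
            obtain ⟨j, rfl⟩ := hfs i (hi ▸ hxS)
            exact ⟨j, hi⟩
        · intro r₁ f g hf hg hfx hfs hgq hgs
          obtain ⟨hinj, hran⟩ := linkRows_range Y 𝒜 x hxY u hu hrows f hf hfx hfs
          obtain ⟨hcinj, hcran⟩ := linkCols_range Q Qs q₀ hq₀Q cols hcols hcolr g hg hgq hgs
          rw [Finset.erase_eq_of_notMem hq₀s] at hcran
          have hfilt : (𝒜.filter fun A => x ∈ A).card = Qs.card + 1 := by
            rw [Finset.filter_true_of_mem hall, h𝒜c]
          refine ih (Y.erase x) (Q.erase q₀) Qs ((𝒜.filter fun A => x ∈ A).image fun A => A.erase x) r₁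
            (fun j => (u (f j)).erase x) (fun j => (cols (g j)).erase q₀) ?_ ?_ ?_ hcle
            (linkFamily_subset Y 𝒜 x h𝒜Y) (linkFamily_up Y 𝒜 x hxY hup) ?_ hinj hran hcinj hcran
          · rw [Finset.card_erase_of_mem hxY, hY]; rfl
          · rw [Finset.card_erase_of_mem hq₀Q, hQ]; rfl
          · exact Finset.subset_erase.mpr ⟨hQs, hq₀s⟩
          · rw [linkFamily_card, hfilt]


end SymbJoin

/-! ## 2. The lower co-star theorem and the node cell, modulo stuck shapes -/

namespace CoStar

/-- **THE LOWER CO-STAR THEOREM MODULO STUCK SHAPES.** If every stuck saturated co-star instance of dimension `5 ≤ c' ≤ c` (inside `Fin h`) is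
generically good, then the co-star `T_{h,c}` serves EVERY injective lower row family of size `2^h − (c+1)`. -/
theorem coStarLower_exists_table_of_stuck (h c r m : ℕ) (p₀ : Fin m)
    (hstuck : ∀ (Y : Finset (Fin h)) (Q : Finset (Fin h)) (𝒜 : Finset (Finset (Fin h))) (r' : ℕ)
      (u : Fin r' → Finset (Fin h)) (cols : Fin r' → Finset (Fin h)),
      Y.card = Q.card → 5 ≤ Q.card → Q.card ≤ c →
      (∀ A ∈ 𝒜, A ⊆ Y) → (∀ A ∈ 𝒜, ∀ A', A ⊆ A' → A' ⊆ Y → A' ∈ 𝒜) → 𝒜.card = Q.card + 1 →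
      (∀ x ∈ Y, (𝒜.filter fun A => x ∉ A).card ≠ 1) →
      Function.Injective u → (∀ S, (∃ i, u i = S) ↔ S ⊆ Y ∧ S ∉ 𝒜) →
      Function.Injective cols → (∀ J, (∃ k, cols k = J) ↔ J ⊆ Q ∧ J ≠ Q ∧ ∀ q ∈ Q, J ≠ Q.erase q) →
      SymbJoin.symDet u (fun k => (p₀, cols k)) ≠ 0)
    (qs : Fin c → Fin h) (hqs : Function.Injective qs) (hr : r + (c + 1) = 2 ^ h)
    (cols : Fin r → Finset (Fin h)) (hcols : Function.Injective cols) (hcu : ∀ k, cols k ≠ Finset.univ)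
    (hcq : ∀ k j, cols k ≠ Finset.univ.erase (qs j))
    (u : Fin r → Finset (Fin h)) (hu : Function.Injective u) (hlow : IsLowerSet (Set.range u)) :
    ∃ tx : Fin m → Option (Fin h) → Fin h → ℂ,
      (Matrix.of fun i k : Fin r =>
        ∏ x ∈ u i, (tx p₀ none x + ∑ q ∈ cols k, tx p₀ (some q) x)).det ≠ 0 := by
  classical
  set 𝒜 : Finset (Finset (Fin h)) := Finset.univ \ Finset.univ.image u with h𝒜
  have h𝒜card : 𝒜.card = (Finset.univ.image qs).card + 1 := by
    rw [h𝒜, Finset.card_sdiff_of_subset (Finset.subset_univ _), Finset.card_univ, Fintype.card_finset, Fintype.card_fin,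
      Finset.card_image_of_injective _ hu, Finset.card_univ, Fintype.card_fin, Finset.card_image_of_injective _ hqs,
      Finset.card_univ, Fintype.card_fin]
    omega
  have hrows : ∀ S, (∃ i, u i = S) ↔ S ⊆ Finset.univ ∧ S ∉ 𝒜 := by
    intro S
    rw [h𝒜, Finset.mem_sdiff, not_and, not_not, Finset.mem_image]
    constructor
    · rintro ⟨i, rfl⟩; exact ⟨Finset.subset_univ _, fun _ => ⟨i, Finset.mem_univ _, rfl⟩⟩
    · rintro ⟨-, hS⟩; obtain ⟨i, -, hi⟩ := hS (Finset.mem_univ _); exact ⟨i, hi⟩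
  have hup : ∀ A ∈ 𝒜, ∀ A', A ⊆ A' → A' ⊆ Finset.univ → A' ∈ 𝒜 := by
    intro A hA A' hAA' _
    rw [h𝒜, Finset.mem_sdiff] at hA ⊢
    refine ⟨Finset.mem_univ _, fun hA' => hA.2 ?_⟩
    obtain ⟨i, -, rfl⟩ := Finset.mem_image.mp hA'
    obtain ⟨j, hj⟩ := hlow hAA' ⟨i, rfl⟩
    exact Finset.mem_image.mpr ⟨j, Finset.mem_univ _, hj⟩
  have hG := SymbJoin.coStar_subcube_symGood_of_stuck (n := h) (K := h) p₀ c hstuck h Finset.univ Finset.univ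
    (Finset.univ.image qs) 𝒜 r u cols (by rw [Finset.card_univ, Fintype.card_fin]) (by rw [Finset.card_univ, Fintype.card_fin])
    (Finset.subset_univ _) (by rw [Finset.card_image_of_injective _ hqs, Finset.card_univ, Fintype.card_fin])
    (fun A _ => Finset.subset_univ A) hup h𝒜card hu hrows hcols (coStar_cols_range qs hqs hr cols hcols hcu hcq)
  exact SymbJoin.exists_table_of_symGood u (fun k => (p₀, cols k)) hG

/-- **The lower node at `r = 2^h − (c+1)` modulo the stuck shapes of dimensions `5..c`** (`1 ≤ h`, `c ≤ h`; one piece, `K = h`). -/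
theorem universalJoinWideLower_of_stuck (h c r : ℕ) (h1 : 1 ≤ h) (hch : c ≤ h)
    (hstuck : ∀ (Y : Finset (Fin h)) (Q : Finset (Fin h)) (𝒜 : Finset (Finset (Fin h))) (r' : ℕ)
      (u : Fin r' → Finset (Fin h)) (cols : Fin r' → Finset (Fin h)),
      Y.card = Q.card → 5 ≤ Q.card → Q.card ≤ c →
      (∀ A ∈ 𝒜, A ⊆ Y) → (∀ A ∈ 𝒜, ∀ A', A ⊆ A' → A' ⊆ Y → A' ∈ 𝒜) → 𝒜.card = Q.card + 1 →
      (∀ x ∈ Y, (𝒜.filter fun A => x ∉ A).card ≠ 1) →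
      Function.Injective u → (∀ S, (∃ i, u i = S) ↔ S ⊆ Y ∧ S ∉ 𝒜) →
      Function.Injective cols → (∀ J, (∃ k, cols k = J) ↔ J ⊆ Q ∧ J ≠ Q ∧ ∀ q ∈ Q, J ≠ Q.erase q) →
      SymbJoin.symDet u (fun k => ((0 : Fin 1), cols k)) ≠ 0)
    (hr : r + (c + 1) = 2 ^ h) :
    ∃ (m K : ℕ) (W : Fin m → ℕ) (wt : Fin m → Fin K → ℕ) (e : Fin r → Fin m × Finset (Fin K)),
      m ≤ h + h ∧ K ≤ h * h * h ∧ Function.Injective e ∧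
      (∀ x : Fin m × Finset (Fin K), x ∉ Set.range e →
        ∀ i, W (e i).1 + ∑ k ∈ (e i).2, wt (e i).1 k < W x.1 + ∑ k ∈ x.2, wt x.1 k) ∧
      ∀ u : Fin r → Finset (Fin h), Function.Injective u → IsLowerSet (Set.range u) →
        ∃ tx : Fin m → Option (Fin K) → Fin h → ℂ,
          (Matrix.of fun i k : Fin r =>
            ∏ a ∈ u i, (tx (e k).1 none a + ∑ q ∈ (e k).2, tx (e k).1 (some q) a)).det ≠ 0 := by
  classical
  let qs : Fin c → Fin h := fun j => Fin.castLE hch j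
  have hqs : Function.Injective qs := fun j j' hjj => Fin.castLE_injective hch hjj
  obtain ⟨cols, hcols, hcu, hcq, hthr⟩ := coStar_design h c r h1 qs hqs hr
  refine ⟨1, h, fun _ => 0, fun _ q => if q ∈ Finset.univ.image qs then 1 else 2, fun k => ((0 : Fin 1), cols k), by omega,
    le_trans (Nat.le_mul_of_pos_right h h1) (Nat.le_mul_of_pos_right _ h1), ?_, hthr, ?_⟩
  · intro k k' hkk
    exact hcols (congrArg Prod.snd hkk)
  · intro u hu hlow
    exact coStarLower_exists_table_of_stuck h c r 1 (0 : Fin 1) hstuck qs hqs hr cols hcols hcu hcq u hu hlow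

end CoStar

end

end Summit.ValiantsHypothesis.ValiantsHypothesis.Theorems.BarrierLever.HiddenStates
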